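import Mathlib
import HarnessLib
import Summits.HubbardSuperconductivity.HubbardSuperconductivity.Theorems.WeakCouplingBCSWcbcsKohnLuttingerB1gKlCertFormD
import Summits.HubbardSuperconductivity.HubbardSuperconductivity.Theorems.WeakCouplingBCSDefsKlCertB1gWinARecord
import Summits.HubbardSuperconductivity.HubbardSuperconductivity.Theorems.WeakCouplingBCSDefsKlCertB1gWinBRecord
import Summits.HubbardSuperconductivity.HubbardSuperconductivity.Theorems.WeakCouplingBCSDefsKlCertB1gWinCRecord
import Summits.HubbardSuperconductivity.HubbardSuperconductivity.Theorems.WeakCouplingBCSDefsKlU0WindowRecord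
import Summits.HubbardSuperconductivity.HubbardSuperconductivity.Theorems.WeakCouplingBCSDefsKlThirdOrderWindow
import Summits.HubbardSuperconductivity.HubbardSuperconductivity.Theorems.WeakCouplingBCSKlThirdOrderSelection

/-!
# Route `WeakCouplingBCS` — channel-margin lane of `WcbcsKohnLuttingerB1g` (stmt-HubbardSuperconductivity-0158):
# third-order `B1g` selection on the WHOLE chemical-potential window `[-0.42749, -0.1775] ⊃ μ([0.10, 0.20])`

The window record of explicit-`U₀` rows (`klU0WindowRows`, 44 boxes, uniform threshold `klU0WindowU = 1145/2²⁴`,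
`Theorems/WeakCouplingBCSDefsKlU0WindowRecord.lean`; soundness `klU0Window_sound` for ARBITRARY functions `lamB, lamX`) read as a
statement about the truncated vertex form `thirdOrderForm ε₀ μ U` of `Theorems/WeakCouplingBCSDefsKlThirdOrder.lean` (the
particle–particle-irreducible Cooper vertex through third order, divided by `U²`):

* `klto_lower_of_basicOKB1gD`, `klThirdOrder_selectionD` — the multiplicity-aware (`checkB1gD`) variants of the one-box statements of
  `WeakCouplingBCSKlThirdOrderSelection.lean` (`klb1gd_blockLower` in place of `stub_klBlockBounds`);
* **`klThirdOrder_selection_windowRows`** (generic): a window of rows passing `klU0WinCheck mub mua u`, joined (`klThirdOrderWindowJoin`) to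
  second-order records that pass `checkB1gD` and whose `EnclosuresB1g` hold, together with the NAMED window hypotheses
  `KlThirdOrderWindowEnclosures rows recs` ⟹ for every `μ ∈ [mub, mua]` some `B1g` channel state lies strictly below every normalised
  `A1g/A2g/B2g/E` state of `thirdOrderForm ε₀ μ U` for all `0 < U ≤ u`;
* **`klThirdOrder_selection_window`** — the instance: rows `klU0WindowRows`, records `klCertB1gWinA/B/C` (join by `decide +kernel`), threshold
  `klU0WindowU ≈ 6.8·10⁻⁵`, modulo `klCertB1gWin{A,B,C}.EnclosuresB1g` (the hypotheses of the window form of item 0158) and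
  `KlThirdOrderWindowEnclosures klU0WindowRows [klCertB1gWinA, klCertB1gWinB, klCertB1gWinC]` (certified: U0-TABLE.md v3 §4, two interval
  implementations, referee-replayed REF-CHECK §133); `klThirdOrder_selection_window_doping` — the same for every `δ ∈ [0.10, 0.20]` through
  `μ(δ) = chemicalPotentialOfDensity ε₀ (1-δ)` (`muOfDoping_mem_window_d010_d020`).

Honest framing: conditional on named numerical hypotheses certified by the cell's interval arithmetic (not in-kernel); existence-grade
threshold; orders `≥ 4` not addressed; nothing here asserts a pairing instability.  Cell file U0-TABLE.md v3.1.
-/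

noncomputable section

-- the tree's namespace `Summit.<Summit>.<Problem>.Theorems` repeats the summit name by design (D-0017)
set_option linter.dupNamespace false

namespace Summit.HubbardSuperconductivity.HubbardSuperconductivity.Theorems

open MeasureTheory Literature.MathematicalPhysics.QuantumLattice CwKLChiralWindow KlThirdOrder

/-- The certified lower bounds of a box passing the multiplicity-aware test `basicOKB1gD` (`klb1gd_blockLower`), given the block
enclosures at `μ`, and the usable `B1g` Ritz data. [folklore] -/
theorem klto_lower_of_basicOKB1gD {μ : ℝ} (hμ : μ ∈ Set.Ioo (-4 : ℝ) 0) (bx : KLBox) (tab : List KLTrig)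
    (hB : bx.basicOKB1gD tab = true) (hE : ∀ χ : D4Irrep, χ ≠ D4Irrep.B1g → (bx.blk χ).Enclosure tab μ χ) :
    bx.bB1g.ritzOK tab D4Irrep.B1g = true ∧ ∀ χ : D4Irrep, χ ≠ D4Irrep.B1g →
      (((bx.blk χ).lower tab χ : ℚ) : ℝ) ≤ channelInf (squareDispersion 1 0) μ 1 χ := by
  have hB' := hB
  simp only [KLBox.basicOKB1gD, Bool.and_eq_true, decide_eq_true_eq] at hB'
  obtain ⟨⟨⟨⟨⟨⟨⟨-, -⟩, -⟩, hritz⟩, hA1⟩, hA2⟩, hB2⟩, hEE⟩ := hB'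
  refine ⟨hritz, fun χ hχ => klb1gd_blockLower hμ (bx.blk χ) tab χ (hE χ hχ) ?_⟩
  cases χ with
  | A1g => exact hA1
  | A2g => exact hA2
  | B1g => exact absurd rfl hχ
  | B2g => exact hB2
  | E => exact hEE

/-- **Third-order `B1g` selection, one box of a multiplicity-aware record** (`basicOKB1gD`): as `klThirdOrder_selection`, with the lower
bounds certified by `klb1gd_blockLower`. [cite: RaghuKivelsonScalapino2010, App. A] -/
theorem klThirdOrder_selectionD {μ : ℝ} (hμ : μ ∈ Set.Ioo (-4 : ℝ) 0) (bx : KLBox) (tab : List KLTrig)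
    (hB : bx.basicOKB1gD tab = true) (hER : bx.bB1g.RitzEnclosure tab μ)
    (hE : ∀ χ : D4Irrep, χ ≠ D4Irrep.B1g → (bx.blk χ).Enclosure tab μ χ)
    (r : KLU0Row) (hr : r.ok = true) (hdom : r.dominates bx tab = true)
    (h3 : r.ThirdOrderEnclosures μ (bx.bB1g.trialFun tab)) :
    ∃ ψ : Momentum → ℝ, IsChannelState (squareDispersion 1 0) μ D4Irrep.B1g ψ ∧
      ∀ U : ℝ, 0 < U → U ≤ r.U0 → ∀ χ : D4Irrep, χ ≠ D4Irrep.B1g →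
        ∀ φ : Momentum → ℝ, IsChannelState (squareDispersion 1 0) μ χ φ →
          thirdOrderForm (squareDispersion 1 0) μ U ψ < thirdOrderForm (squareDispersion 1 0) μ U φ := by
  obtain ⟨hritz, hlower⟩ := klto_lower_of_basicOKB1gD hμ bx tab hB hE
  obtain ⟨ψ, hψ, h⟩ := klThirdOrder_selection_of_lower hμ bx tab hritz hER hlower r hr hdom h3
  exact ⟨ψ, hψ, fun U hU hUU χ hχ => (h U hU hUU χ hχ).1⟩

/-- **Third-order selection on a window of rows** (generic).  Let `rows` pass the window checker `klU0WinCheck mub mua u` (contiguous cover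
of `[mub, mua]`, every row `ok` with `u ≤ U0`), let every record of `recs` pass `checkB1gD` with its enclosures `EnclosuresB1g`, let the rows be
joined to the records' boxes (`klThirdOrderWindowJoin`), and let the named window hypotheses `KlThirdOrderWindowEnclosures rows recs` hold.
Then for every `μ ∈ [mub, mua]` some `B1g` channel state on `F_μ` lies strictly below every normalised `A1g/A2g/B2g/E` state of
`thirdOrderForm ε₀ μ U`, for all `0 < U ≤ u`. [cite: RaghuKivelsonScalapino2010, App. A] -/
theorem klThirdOrder_selection_windowRows (rows : List KLU0WinRow) (recs : List KLCert) (mub mua u : ℚ)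
    (hcheck : klU0WinCheck mub mua u rows = true) (hjoin : klThirdOrderWindowJoin rows recs = true)
    (hrec : ∀ c ∈ recs, c.checkB1gD = true ∧ c.EnclosuresB1g)
    (h3 : KlThirdOrderWindowEnclosures rows recs) :
    ∀ μ : ℝ, ((mub : ℚ) : ℝ) ≤ μ → μ ≤ ((mua : ℚ) : ℝ) →
      ∃ ψ : Momentum → ℝ, IsChannelState (squareDispersion 1 0) μ D4Irrep.B1g ψ ∧
        ∀ U : ℝ, 0 < U → U ≤ ((u : ℚ) : ℝ) → ∀ χ : D4Irrep, χ ≠ D4Irrep.B1g →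
          ∀ φ : Momentum → ℝ, IsChannelState (squareDispersion 1 0) μ χ φ →
            thirdOrderForm (squareDispersion 1 0) μ U ψ < thirdOrderForm (squareDispersion 1 0) μ U φ := by
  intro μ hμ₁ hμ₂
  obtain ⟨-, hcov⟩ := klU0Win_cover mub mua u rows hcheck
  obtain ⟨w, hw, hlo, hhi, hok, hu⟩ := hcov μ hμ₁ hμ₂
  obtain ⟨c, hc, bx, hbx, hcl, hch, hdom⟩ := klThirdOrderWindowJoin_spec rows recs hjoin w hw
  obtain ⟨hcheckc, hEc⟩ := hrec c hc
  obtain ⟨-, hboxes, -⟩ := klb1gd_coverLogic c hcheckc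
  obtain ⟨hB, -⟩ := hboxes bx hbx
  have hB' := hB
  simp only [KLBox.basicOKB1gD, Bool.and_eq_true, decide_eq_true_eq] at hB'
  obtain ⟨⟨⟨⟨⟨⟨⟨h4, -⟩, h0⟩, -⟩, -⟩, -⟩, -⟩, -⟩ := hB'
  have hlo' : ((bx.mulo : ℚ) : ℝ) ≤ μ := le_trans (by exact_mod_cast hcl) hlo
  have hhi' : μ ≤ ((bx.muhi : ℚ) : ℝ) := le_trans hhi (by exact_mod_cast hch)
  have hμ : μ ∈ Set.Ioo (-4 : ℝ) 0 :=
    ⟨lt_of_lt_of_le (by exact_mod_cast h4) hlo', lt_of_le_of_lt hhi' (by exact_mod_cast h0)⟩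
  obtain ⟨hER, hEχ⟩ := hEc bx hbx μ ⟨hlo', hhi'⟩
  have h3w := h3 w hw c hc bx hbx hcl hch hdom μ hlo hhi
  obtain ⟨ψ, hψ, hsel⟩ := klThirdOrder_selectionD hμ bx c.trials hB hER hEχ w.row hok hdom h3w
  refine ⟨ψ, hψ, fun U hU hUu => hsel U hU (le_trans hUu (by exact_mod_cast hu))⟩

/-! ### The instance: `klU0WindowRows` against `klCertB1gWinA/B/C` -/

/-- Kernel decision: every one of the 44 window rows sits in a box of `klCertB1gWinA`, `klCertB1gWinB` or `klCertB1gWinC` with which it is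
consistent (same `rhohi`, lows dominated by the box's certified lower bounds, four competitors, `U1 ≤ 1`). [folklore] -/
theorem klto_window_join :
    klThirdOrderWindowJoin klU0WindowRows [klCertB1gWinA, klCertB1gWinB, klCertB1gWinC] = true := by
  decide +kernel

/-- The three window records pass the multiplicity-aware checker (kernel decisions of their record files). [folklore] -/
theorem klto_window_recs (hA : klCertB1gWinA.EnclosuresB1g) (hB : klCertB1gWinB.EnclosuresB1g)
    (hC : klCertB1gWinC.EnclosuresB1g) :
    ∀ c ∈ [klCertB1gWinA, klCertB1gWinB, klCertB1gWinC], c.checkB1gD = true ∧ c.EnclosuresB1g := by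
  intro c hc
  simp only [List.mem_cons, List.mem_nil_iff, or_false] at hc
  rcases hc with rfl | rfl | rfl
  · exact ⟨klCertB1gWinA_check, hA⟩
  · exact ⟨klCertB1gWinB_check, hB⟩
  · exact ⟨klCertB1gWinC_check, hC⟩

/-- **`B1g` selection survives the complete third order of the pp-irreducible Cooper vertex on the WHOLE window**: for every
`μ ∈ [-0.42749, -0.1775]` and every `0 < U ≤ klU0WindowU = 1145/2²⁴ ≈ 6.8·10⁻⁵`, some `B1g` channel state on `F_μ` lies strictly below every
normalised `A1g`, `A2g`, `B2g`, `E` state of `thirdOrderForm ε₀ μ U` — modulo the NAMED numerical hypotheses `klCertB1gWin{A,B,C}.EnclosuresB1g`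
(second order; certified, referee-replayed) and `KlThirdOrderWindowEnclosures klU0WindowRows [klCertB1gWinA, klCertB1gWinB, klCertB1gWinC]`
(third order; certified in two interval implementations on every box, U0-TABLE.md v3 §4, REF-CHECK §133).  Existence-grade threshold;
nothing here asserts a pairing instability. [cite: RaghuKivelsonScalapino2010, App. A] -/
theorem klThirdOrder_selection_window (hA : klCertB1gWinA.EnclosuresB1g) (hB : klCertB1gWinB.EnclosuresB1g)
    (hC : klCertB1gWinC.EnclosuresB1g)
    (h3 : KlThirdOrderWindowEnclosures klU0WindowRows [klCertB1gWinA, klCertB1gWinB, klCertB1gWinC]) :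
    ∀ μ : ℝ, ((((-42749 : ℚ) / 100000) : ℚ) : ℝ) ≤ μ → μ ≤ ((((-71 : ℚ) / 400) : ℚ) : ℝ) →
      ∃ ψ : Momentum → ℝ, IsChannelState (squareDispersion 1 0) μ D4Irrep.B1g ψ ∧
        ∀ U : ℝ, 0 < U → U ≤ ((klU0WindowU : ℚ) : ℝ) → ∀ χ : D4Irrep, χ ≠ D4Irrep.B1g →
          ∀ φ : Momentum → ℝ, IsChannelState (squareDispersion 1 0) μ χ φ →
            thirdOrderForm (squareDispersion 1 0) μ U ψ < thirdOrderForm (squareDispersion 1 0) μ U φ :=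
  klThirdOrder_selection_windowRows klU0WindowRows _ _ _ _ klU0WindowRows_check klto_window_join (klto_window_recs hA hB hC) h3

/-- **The same on the doping window of record `δ ∈ [0.10, 0.20]`**, at the free-band chemical potential
`μ(δ) = chemicalPotentialOfDensity ε₀ (1-δ) ∈ [-0.42749, -0.1775]` (`muOfDoping_mem_window_d010_d020`). [cite: RaghuKivelsonScalapino2010, App. A] -/
theorem klThirdOrder_selection_window_doping (hA : klCertB1gWinA.EnclosuresB1g) (hB : klCertB1gWinB.EnclosuresB1g)
    (hC : klCertB1gWinC.EnclosuresB1g)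
    (h3 : KlThirdOrderWindowEnclosures klU0WindowRows [klCertB1gWinA, klCertB1gWinB, klCertB1gWinC])
    (δ : ℝ) (hδ : δ ∈ Set.Icc (0.10 : ℝ) 0.20) :
    ∃ ψ : Momentum → ℝ,
      IsChannelState (squareDispersion 1 0) (chemicalPotentialOfDensity (squareDispersion 1 0) (1 - δ)) D4Irrep.B1g ψ ∧
        ∀ U : ℝ, 0 < U → U ≤ ((klU0WindowU : ℚ) : ℝ) → ∀ χ : D4Irrep, χ ≠ D4Irrep.B1g →
          ∀ φ : Momentum → ℝ,
            IsChannelState (squareDispersion 1 0) (chemicalPotentialOfDensity (squareDispersion 1 0) (1 - δ)) χ φ →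
              thirdOrderForm (squareDispersion 1 0) (chemicalPotentialOfDensity (squareDispersion 1 0) (1 - δ)) U ψ <
                thirdOrderForm (squareDispersion 1 0) (chemicalPotentialOfDensity (squareDispersion 1 0) (1 - δ)) U φ := by
  obtain ⟨h₁, h₂⟩ := muOfDoping_mem_window_d010_d020 δ hδ
  exact klThirdOrder_selection_window hA hB hC h3 _ (by push_cast; linarith) (by push_cast; linarith)

end Summit.HubbardSuperconductivity.HubbardSuperconductivity.Theorems

end
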